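import Summits.MatrixMultiplication.OmegaCensus.SmallFormats.MatMul22nRankGF7LeftMul
import HarnessLib

/-!
# ω-census family (a): the slack-4 column-pattern alphabet of the `𝔽₇` X-cap system up to `PGL₂(7)` (normalised DFS, kernel-checked)

Cell `pub-omega` (unit `pub-omega-tensor-g15`), topic `Summits/MatrixMultiplication/OmegaCensus` (sub-folder `SmallFormats`).
Framing (verbatim): lottery ticket; floor = certified bounds/negative ranges. HONEST FRAMING: kernel infrastructure (step P1 of
`pub-omega-tensor-g15/KERNEL-S4-DESIGN.md`); data generated by `pub-omega-tensor-g15/code/gen_patterndfs.py`; nothing here is progress on `ω`.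

A PATTERN of slack `s` is a function on `Ω` (indices `< 42`) with values `≤ s` whose 48 heptad sums (`heptPt7`) all equal `6s`
(`IsPat7`; the torus columns of a tight point are patterns, `MatMul22nRankGF7TorusCosets.col_hept_sum7/col_le7`). It is NORMALISED
(`IsNorm7`) if its value at `z₀ = 18` (base point of torus `0`) is its minimum and its value at `z₁ = 0` is the minimum over the
`K₀`-orbit `O₁` of `z₁` (`orbO1_7`). THE CHECK (`dfs7`, one `decide +kernel` split by the first value, 144602 nodes): a depth-42 search assigning the
points of `Ω` in the fixed order `ord7`, each value ranging over `[lo, s]` (`lo` = the normalisation bounds already available), except that a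
point completing a heptad (static table `complOff7/complH7`) is FORCED to `6s −` (sum of the other six); every complete assignment reached must
be in the list `normList7` of the 841 normalised slack-4 patterns (packed, digit `z` = value `+ 1` in base `8`). SOUNDNESS (`dfs7_sound`,
`normList7_complete`): every normalised slack-4 pattern is (pointwise) one of the listed ones. Each listed pattern is a class representative
`repVal7 c` (`c < 120`, the `PGL₂(7)`-orbits) composed with the action of a generator word (`normCert7_ok`), so every normalised pattern is
`z ↦ repVal7 c (lmulOmW7 w z)` for some `c < 120` and word `w` (`norm_pattern_rep7`).
-/

namespace Summit.MatrixMultiplication.OmegaCensus.SmallFormats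

open Finset
open Literature.NumberTheory.NumberFields (list_sum_range_map)

/-! ## Base-8 packing (digit lemmas, as for `pack24`) -/

/-- Pack the first `n` entries of `f` (each meant to be `< 8`) in base `8`. -/
def pack3 (f : ℕ → ℕ) (n : ℕ) : ℕ := ∑ i ∈ range n, f i * 2 ^ (3 * i)

/-- The low part of a packing is below the next power of the base. -/
theorem pack3_lt (f : ℕ → ℕ) (n : ℕ) (hf : ∀ i < n, f i < 2 ^ 3) : pack3 f n < 2 ^ (3 * n) := by
  induction n with
  | zero => simp [pack3]
  | succ n ih =>
    have h1 := ih fun i hi => hf i (by omega)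
    have h3 : f n * 2 ^ (3 * n) ≤ (2 ^ 3 - 1) * 2 ^ (3 * n) :=
      Nat.mul_le_mul_right _ (by have := hf n (by omega); omega)
    have h4 : (2 ^ 3 - 1) * 2 ^ (3 * n) + 2 ^ (3 * n) = 2 ^ (3 * (n + 1)) := by
      rw [show 3 * (n + 1) = 3 + 3 * n by ring, pow_add]; norm_num; ring
    unfold pack3 at h1 ⊢; rw [sum_range_succ]; omega

/-- Splitting a packing at position `j < n`. -/
theorem pack3_split (f : ℕ → ℕ) {n j : ℕ} (hj : j < n) :
    pack3 f n = pack3 f j + f j * 2 ^ (3 * j) + 2 ^ (3 * (j + 1)) * ∑ i ∈ range (n - (j + 1)), f (j + 1 + i) * 2 ^ (3 * i) := by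
  unfold pack3
  have hn : n = (j + 1) + (n - (j + 1)) := by omega
  conv_lhs => rw [hn, sum_range_add, sum_range_succ]
  congr 1
  rw [mul_sum]
  refine sum_congr rfl fun i _ => ?_
  rw [show 3 * (j + 1 + i) = 3 * (j + 1) + 3 * i by ring, pow_add]
  ring

/-- **Digit extraction** for `pack3`. -/
theorem pack3_digit (f : ℕ → ℕ) {n : ℕ} (hf : ∀ i < n, f i < 2 ^ 3) {j : ℕ} (hj : j < n) :
    pack3 f n / 2 ^ (3 * j) % 2 ^ 3 = f j := by
  rw [pack3_split f hj]
  have hlow : pack3 f j < 2 ^ (3 * j) := pack3_lt f j fun i hi => hf i (by omega)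
  set C := ∑ i ∈ range (n - (j + 1)), f (j + 1 + i) * 2 ^ (3 * i) with hC
  have hpos : 0 < 2 ^ (3 * j) := Nat.two_pow_pos _
  have e1 : (pack3 f j + f j * 2 ^ (3 * j) + 2 ^ (3 * (j + 1)) * C) / 2 ^ (3 * j) = f j + 2 ^ 3 * C := by
    rw [show 2 ^ (3 * (j + 1)) * C = (2 ^ 3 * C) * 2 ^ (3 * j) by
      rw [show 3 * (j + 1) = 3 * j + 3 by ring, pow_add]; ring]
    rw [add_assoc, ← add_mul, Nat.add_mul_div_right _ _ hpos, Nat.div_eq_of_lt hlow, zero_add]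
  rw [e1, Nat.add_mul_mod_self_left, Nat.mod_eq_of_lt (hf j hj)]

/-- `fld 3` reads base-8 digits. -/
theorem fld3_eq (N z : ℕ) : fld 3 N z = N / 2 ^ (3 * z) % 2 ^ 3 := by
  unfold fld; rw [Nat.and_two_pow_sub_one_eq_mod, Nat.shiftRight_eq_div_pow]

/-! ## Patterns, normalisation -/

/-- A column pattern of slack `s`: values `≤ s` on `Ω` and all 48 heptad sums equal to `6s`. -/
def IsPat7 (s : ℕ) (P : ℕ → ℕ) : Prop :=
  (∀ z < 42, P z ≤ s) ∧ ∀ y < 8, ∀ b < 6, ∑ i ∈ range 7, P (heptPt7 y b i) = 6 * s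

/-- The `K₀`-orbit `O₁` of `z₁ = 0` (`8` fields of `6` bits). -/
def orbO1_7 (i : ℕ) : ℕ := fld 6 178430478680320 i

/-- Normalised pattern: minimum at `z₀ = 18`, and minimum over `O₁` at `z₁ = 0`. -/
def IsNorm7 (P : ℕ → ℕ) : Prop := (∀ z < 42, P 18 ≤ P z) ∧ ∀ i < 8, P 0 ≤ P (orbO1_7 i)

/-! ## Search tables (generated) -/

/-- The assignment order: `ord7 k` is the point assigned at step `k` (`6`-bit fields; `ord7 0 = z₀`, `ord7 1 = z₁`). -/
def ord7 (k : ℕ) : ℕ := fld 6 4707943902699325083386897083289054172104392508507513885283980864620078325778 k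
/-- Offsets into `complH7`: the heptads completed at step `k` are `complH7 i`, `complOff7 k ≤ i < complOff7 (k+1)`. -/
def complOff7 (k : ℕ) : ℕ := fld 6 351960308586777460528952595967404788448778196541560794457862481863469866942464 k
/-- Heptads (as `6y + b`) in completion order. -/
def complH7 (i : ℕ) : ℕ := fld 6 339053414994324982964671202734222689260788857943781681685220671220601560745287501105152 i
/-- Whether step `k ≥ 2` assigns a point of `O₁`. -/
def inO1_7 (k : ℕ) : Bool := fld 1 1099531059776 k == 1

/-! ## The checker -/

/-- Digit of the packed partial assignment: `0` = unassigned, `v + 1` = value `v`. -/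
def dg7 (A z : ℕ) : ℕ := fld 3 A z

/-- Sum of the values of the points of heptad `h = 6y + b` other than `z` (read from the packed assignment). -/
def othSum7 (A h z : ℕ) : ℕ :=
  ((List.range 7).map fun i => if heptPt7 (h / 6) (h % 6) i = z then 0 else dg7 A (heptPt7 (h / 6) (h % 6) i) - 1).sum

/-- Candidate values at step `k`: `[lo, s]` with the normalisation bound `lo`, or the single forced value when step `k` completes heptads. -/
def cands7 (s A k : ℕ) : List ℕ :=
  let lo := max (if k = 0 then 0 else dg7 A 18 - 1) (if inO1_7 k then dg7 A 0 - 1 else 0)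
  let F := (List.range (complOff7 (k + 1) - complOff7 k)).map fun t => 6 * s - othSum7 A (complH7 (complOff7 k + t)) (ord7 k)
  match F with
  | [] => (List.range (s + 1 - lo)).map (· + lo)
  | v :: F' => if F'.all (· == v) && decide (lo ≤ v) && decide (v ≤ s) then [v] else []

/-- The search: from the partial assignment `A` of the first `k` points, every completion reached must be in `L`. -/
def dfs7 (s : ℕ) (L : List ℕ) : ℕ → ℕ → ℕ → Bool
  | 0, _, _ => false
  | fuel + 1, k, A => if 42 ≤ k then L.elem A else
      (cands7 s A k).all fun v => dfs7 s L fuel (k + 1) (A + (v + 1) * 2 ^ (3 * ord7 k))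

/-! ## Table facts -/

set_option maxRecDepth 100000 in
/-- `ord7` is injective on `[0, 42)` with values `< 42`, starts `z₀, z₁`. -/
theorem ord7_ok : (∀ i j : Fin 42, ord7 i.val = ord7 j.val → i = j) ∧ (∀ i : Fin 42, ord7 i.val < 42) ∧ ord7 0 = 18 ∧ ord7 1 = 0 := by
  refine ⟨by decide, by decide, by decide, by decide⟩

set_option maxRecDepth 100000 in
set_option maxHeartbeats 4000000 in
/-- Completion table: every heptad completed at step `k` has `y < 8`, `b < 6`, contains `ord7 k` exactly once, and its other points are
assigned before step `k`; `complOff7` is monotone with steps `≤ 8` and `complOff7 42 ≤ 48`. -/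
theorem compl7_ok : ∀ k : Fin 42, complOff7 k.val ≤ complOff7 (k.val + 1) ∧ complOff7 (k.val + 1) ≤ 48 ∧
    complOff7 (k.val + 1) - complOff7 k.val ≤ 8 ∧
    ∀ t : Fin 8, complOff7 k.val + t.val < complOff7 (k.val + 1) →
      complH7 (complOff7 k.val + t.val) / 6 < 8 ∧
      (((List.range 7).filter fun i => heptPt7 (complH7 (complOff7 k.val + t.val) / 6) (complH7 (complOff7 k.val + t.val) % 6) i
          == ord7 k.val).length = 1) ∧
      ∀ i : Fin 7, heptPt7 (complH7 (complOff7 k.val + t.val) / 6) (complH7 (complOff7 k.val + t.val) % 6) i.val ≠ ord7 k.val →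
        ∃ i' : Fin 42, i'.val < k.val ∧ ord7 i'.val = heptPt7 (complH7 (complOff7 k.val + t.val) / 6) (complH7 (complOff7 k.val + t.val) % 6) i.val := by
  decide +kernel

set_option maxRecDepth 100000 in
/-- Normalisation table: `inO1_7 k` only for `k ≥ 2`, and then `ord7 k ∈ O₁`. -/
theorem inO1_7_ok : ∀ k : Fin 42, inO1_7 k.val = true → 2 ≤ k.val ∧ ∃ i : Fin 8, orbO1_7 i.val = ord7 k.val := by decide

/-! ## Soundness -/

/-- Packed partial assignment of the first `k` points of `P`. -/
def Apack7 (P : ℕ → ℕ) (k : ℕ) : ℕ := ∑ i ∈ range k, (P (ord7 i) + 1) * 2 ^ (3 * ord7 i)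

/-- The packed pattern (all 42 points). -/
def packP7 (P : ℕ → ℕ) : ℕ := Apack7 P 42

/-- Digits of the packed partial assignment. -/
theorem dg7_Apack7 {s : ℕ} (hs : s ≤ 6) {P : ℕ → ℕ} (hP : ∀ z < 42, P z ≤ s) {k : ℕ} (hk : k ≤ 42) {i : ℕ} (hi : i < 42) :
    dg7 (Apack7 P k) (ord7 i) = if i < k then P (ord7 i) + 1 else 0 := by
  obtain ⟨hinj, hlt, _, _⟩ := ord7_ok
  -- re-index the packed sum over the image of `ord7`
  set g : ℕ → ℕ := fun z => if z ∈ (range k).image ord7 then P z + 1 else 0 with hg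
  have himg : (range k).image ord7 ⊆ range 42 := by
    intro z hz; rw [mem_image] at hz; obtain ⟨a, ha, rfl⟩ := hz
    exact mem_range.2 (hlt ⟨a, by have := mem_range.1 ha; omega⟩)
  have hinj' : Set.InjOn ord7 ↑(range k) := by
    intro a ha b hb hab
    have := hinj ⟨a, by have := mem_range.1 (Finset.mem_coe.1 ha); omega⟩ ⟨b, by have := mem_range.1 (Finset.mem_coe.1 hb); omega⟩ hab
    simpa using this
  have hA : Apack7 P k = pack3 g 42 := by
    unfold Apack7 pack3
    rw [← sum_image (f := fun z => (P z + 1) * 2 ^ (3 * z)) hinj']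
    rw [← sum_subset himg (fun z _ hz => by simp only [hg, if_neg hz, zero_mul])]
    refine sum_congr rfl fun z hz => ?_
    simp only [hg, if_pos hz]
  have hgl : ∀ z < 42, g z < 2 ^ 3 := by
    intro z hz; simp only [hg]; split_ifs <;> [have := hP z hz; skip] <;> omega
  unfold dg7
  rw [fld3_eq, hA, pack3_digit g hgl (hlt ⟨i, hi⟩)]
  simp only [hg, mem_image, mem_range]
  by_cases hik : i < k
  · rw [if_pos ⟨i, hik, rfl⟩, if_pos hik]
  · rw [if_neg, if_neg hik]
    rintro ⟨a, ha, hai⟩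
    have := hinj ⟨a, by omega⟩ ⟨i, hi⟩ hai
    simp only [Fin.mk.injEq] at this
    omega

/-- **Key step.** At step `k < 42`, the true value `P (ord7 k)` of a normalised pattern is among the candidates computed from its own
partial packing. -/
theorem mem_cands7 {s : ℕ} (hs : s ≤ 6) {P : ℕ → ℕ} (hP : IsPat7 s P) (hN : IsNorm7 P) {k : ℕ} (hk : k < 42) :
    P (ord7 k) ∈ cands7 s (Apack7 P k) k := by
  obtain ⟨hinj, hlt, h0, h1⟩ := ord7_ok
  obtain ⟨hbox, hhept⟩ := hP
  have hzk : ord7 k < 42 := hlt ⟨k, hk⟩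
  have hPk : P (ord7 k) ≤ s := hbox _ hzk
  have hdg : ∀ i < 42, dg7 (Apack7 P k) (ord7 i) = if i < k then P (ord7 i) + 1 else 0 :=
    fun i hi => dg7_Apack7 hs hbox (by omega) hi
  -- the normalisation bound
  have hlo : max (if k = 0 then 0 else dg7 (Apack7 P k) 18 - 1) (if inO1_7 k then dg7 (Apack7 P k) 0 - 1 else 0) ≤ P (ord7 k) := by
    refine max_le ?_ ?_
    · by_cases hk0 : k = 0
      · rw [if_pos hk0]; exact Nat.zero_le _
      · rw [if_neg hk0, ← h0, hdg 0 (by norm_num), if_pos (by omega)]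
        have := hN.1 (ord7 k) hzk; rw [← h0] at this; omega
    · by_cases ho : inO1_7 k = true
      · rw [if_pos ho]
        obtain ⟨h2, i, hi⟩ := inO1_7_ok ⟨k, hk⟩ ho
        have h2' : 2 ≤ k := h2
        have hi' : orbO1_7 i.val = ord7 k := hi
        rw [← h1, hdg 1 (by norm_num), if_pos (by omega)]
        have := hN.2 i.val i.isLt; rw [hi'] at this; rw [h1]; omega
      · rw [if_neg ho]; exact Nat.zero_le _
  -- every forced value equals P (ord7 k)
  obtain ⟨hmono, h48, h8, hcomp⟩ := compl7_ok ⟨k, hk⟩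
  have hmono' : complOff7 k ≤ complOff7 (k + 1) := hmono
  have h8' : complOff7 (k + 1) - complOff7 k ≤ 8 := h8
  have hforced : ∀ t < complOff7 (k + 1) - complOff7 k,
      6 * s - othSum7 (Apack7 P k) (complH7 (complOff7 k + t)) (ord7 k) = P (ord7 k) := by
    intro t ht
    have ht8 : t < 8 := by omega
    have htt : complOff7 k + t < complOff7 (k + 1) := by omega
    obtain ⟨hy, hone, hoth⟩ := hcomp ⟨t, ht8⟩ htt
    set h := complH7 (complOff7 k + t) with hh
    have hb : h % 6 < 6 := Nat.mod_lt _ (by norm_num)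
    have hsum := hhept (h / 6) hy (h % 6) hb
    -- split the heptad sum into the point ord7 k (exactly once) and the others
    have hoth' : othSum7 (Apack7 P k) h (ord7 k)
        = ∑ i ∈ range 7, (if heptPt7 (h / 6) (h % 6) i = ord7 k then 0 else P (heptPt7 (h / 6) (h % 6) i)) := by
      unfold othSum7; rw [list_sum_range_map]
      refine sum_congr rfl fun i hi => ?_
      by_cases he : heptPt7 (h / 6) (h % 6) i = ord7 k
      · rw [if_pos he, if_pos he]
      · rw [if_neg he, if_neg he]
        obtain ⟨i', hi'k, hi'⟩ := hoth ⟨i, mem_range.1 hi⟩ he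
        rw [← hi', hdg i'.val i'.isLt, if_pos hi'k]; simp
    have hsplit : ∑ i ∈ range 7, P (heptPt7 (h / 6) (h % 6) i)
        = ∑ i ∈ range 7, (if heptPt7 (h / 6) (h % 6) i = ord7 k then P (ord7 k) else 0)
          + ∑ i ∈ range 7, (if heptPt7 (h / 6) (h % 6) i = ord7 k then 0 else P (heptPt7 (h / 6) (h % 6) i)) := by
      rw [← sum_add_distrib]; refine sum_congr rfl fun i _ => ?_
      by_cases he : heptPt7 (h / 6) (h % 6) i = ord7 k
      · rw [if_pos he, if_pos he, he]; simp
      · rw [if_neg he, if_neg he]; simp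
    have hcount : ∑ i ∈ range 7, (if heptPt7 (h / 6) (h % 6) i = ord7 k then P (ord7 k) else 0) = P (ord7 k) := by
      rw [← sum_filter, sum_const, smul_eq_mul]
      have hlen : ((range 7).filter fun i => heptPt7 (h / 6) (h % 6) i = ord7 k).card = 1 := by
        have e : ((range 7).filter fun i => heptPt7 (h / 6) (h % 6) i = ord7 k)
            = ((List.range 7).filter fun i => heptPt7 (h / 6) (h % 6) i == ord7 k).toFinset := by
          ext i; simp [beq_iff_eq]
        rw [e, List.card_toFinset, List.Nodup.dedup (List.Nodup.filter _ List.nodup_range)]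
        exact hone
      rw [hlen, one_mul]
    rw [hoth']
    rw [hsplit, hcount] at hsum
    omega
  -- conclude by cases on the forced list
  unfold cands7
  simp only []
  generalize hF : (List.range (complOff7 (k + 1) - complOff7 k)).map
      (fun t => 6 * s - othSum7 (Apack7 P k) (complH7 (complOff7 k + t)) (ord7 k)) = F
  match F, hF with
  | [], _ =>
    exact List.mem_map.2 ⟨P (ord7 k) - max (if k = 0 then 0 else dg7 (Apack7 P k) 18 - 1)
      (if inO1_7 k then dg7 (Apack7 P k) 0 - 1 else 0), List.mem_range.2 (by omega), by omega⟩
  | v :: F', hF =>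
    have hv : v = P (ord7 k) := by
      have : v ∈ v :: F' := by simp
      rw [← hF, List.mem_map] at this
      obtain ⟨t, ht, rfl⟩ := this
      exact hforced t (List.mem_range.1 ht)
    have hall : (F'.all fun w => w == v) = true := by
      rw [List.all_eq_true]; intro w hw
      have : w ∈ v :: F' := by simp [hw]
      rw [← hF, List.mem_map] at this
      obtain ⟨t, ht, rfl⟩ := this
      rw [beq_iff_eq, hforced t (List.mem_range.1 ht), hv]
    have hcond : (F'.all (· == v) && decide (max (if k = 0 then 0 else dg7 (Apack7 P k) 18 - 1)
        (if inO1_7 k then dg7 (Apack7 P k) 0 - 1 else 0) ≤ v) && decide (v ≤ s)) = true := by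
      rw [hall, Bool.true_and, Bool.and_eq_true, decide_eq_true_eq, decide_eq_true_eq, hv]
      exact ⟨hlo, hPk⟩
    dsimp only
    rw [if_pos hcond, hv]
    exact List.mem_singleton.2 rfl

/-- The next packed partial assignment. -/
theorem Apack7_succ (P : ℕ → ℕ) (k : ℕ) : Apack7 P (k + 1) = Apack7 P k + (P (ord7 k) + 1) * 2 ^ (3 * ord7 k) := by
  unfold Apack7; rw [sum_range_succ]

/-- **Soundness of the search.** -/
theorem dfs7_sound {s : ℕ} (hs : s ≤ 6) {L : List ℕ} {P : ℕ → ℕ} (hP : IsPat7 s P) (hN : IsNorm7 P) :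
    ∀ fuel k, k ≤ 42 → dfs7 s L fuel k (Apack7 P k) = true → packP7 P ∈ L := by
  intro fuel
  induction fuel with
  | zero => intro k _ h; simp [dfs7] at h
  | succ fuel ih =>
    intro k hk h
    unfold dfs7 at h
    by_cases h42 : 42 ≤ k
    · rw [if_pos h42] at h
      have hk42 : k = 42 := by omega
      subst hk42
      exact List.elem_iff.1 h
    · rw [if_neg h42] at h
      have hmem := mem_cands7 hs hP hN (k := k) (by omega)
      have h' := List.all_eq_true.1 h _ hmem
      rw [← Apack7_succ] at h'
      exact ih (k + 1) (by omega) h'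

end Summit.MatrixMultiplication.OmegaCensus.SmallFormats
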